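import Summits.PneNP.PneNP.Theorems.PhaseTwinsPolyDepthTwinsAboveDefs

/-!
# Route PhaseTwins, crux `PolyDepthTwinsAbove` (stmt-PneNP-2719), line `parity-wired-ports`: stub `stub_parameters`

The parameter regime of the line is nonempty (pure asymptotic bookkeeping, no cited fact).
With `k := ⌈8/θ⌉₊ + 1` (so `k θ ≥ 8`) and `θ' := 1/(2(k+1))`, put `M = 2(D+1) m₀`, `n = M^k`,
`κ₁ = slyK θ n = ⌊n^{3θ/4}⌋₊`, `κ₂ = ⌊n^{θ/4}⌋₊`, `K = ⌊η M/7⌋₊`. Since `n^{θ/4} = M^{kθ/4} ≥ M²`,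
each of the eleven conjuncts reduces to a threshold `M ≥ C`: `N₀, n₀ ≤ M ≤ n`;
`κ₁ + 2κ₂ ≤ 3κ₁ ≤ slyM d θ n` by the tree lemma `mul_slyK_le_slyM` once `3(d-1) ≤ n^{θ/4}`;
`6M ≤ M² ≤ n^{θ/4}`; `κ₂ (M Lρ + g) ≤ κ₁ LB` from `M² ≤ n^{θ/4}` and `LB M ≥ |Lρ| + g + LB`;
`6 n^{6M} ≤ exp(κ₂ g)` in the logarithmic form `log 6 + 6 k M log M ≤ g (M² - 1)` from
`log M = o(M)` (`Real.isLittleO_log_id_atTop`); `6K ≤ 6ηM/7 < ηM`; `K, κ₂ ≥ 1`; and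
`(6Mv + 10Mκ₂)^{θ'} ≤ K` for `v ≤ 3n` because `6Mv + 10Mκ₂ ≤ 28 M^{k+1} ≤ (28M)^{k+1} ≤ (K²)^{k+1}`
once `K² ≥ 28 M` (`K ≥ ηM/14`, `η² M ≥ 5488`). The finitely many thresholds are collected with
`Filter.eventually_atTop`.
-/

noncomputable section

open scoped Classical BigOperators

namespace Summit.PneNP.PneNP.Cruxes.PolyDepthTwinsAbove.ParityWiredPorts

open Literature.Computability.Complexity (slyM slyK mul_slyK_le_slyM)

set_option linter.dupNamespace false

variable {M v m κ₁ κ₂ : ℕ}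

/-- Linear growth beats constants: `c ≤ a M` for all large naturals `M` (`a > 0`). -/
theorem eventually_le_const_mul_natCast {a : ℝ} (ha : 0 < a) (c : ℝ) :
    ∀ᶠ M : ℕ in Filter.atTop, c ≤ a * (M : ℝ) :=
  (Filter.Tendsto.const_mul_atTop ha tendsto_natCast_atTop_atTop).eventually_ge_atTop c

/-- `log M ≤ ε M` for all large naturals `M` (`ε > 0`), from `log = o(id)` at `+∞`. -/
theorem eventually_log_le_mul_natCast {ε : ℝ} (hε : 0 < ε) :
    ∀ᶠ M : ℕ in Filter.atTop, Real.log M ≤ ε * (M : ℝ) := by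
  have hlo := Real.isLittleO_log_id_atTop.bound hε
  filter_upwards [tendsto_natCast_atTop_atTop.eventually hlo] with M hM
  simp only [id_eq, Real.norm_natCast] at hM
  linarith [Real.le_norm_self (Real.log M)]

/-- **The parameter regime of the line is nonempty.** For `0 < θ < 1/8`, `η, g, LB > 0`, any `Lρ`,
`d ≥ 3` and `D, N₀`, there are `θ' > 0` and `k` such that for every `n₀`, for all large `m₀`, the
parameters `M = 2(D+1)m₀`, `n = M^k`, `κ₁ = slyK θ n`, `κ₂ = ⌊n^{θ/4}⌋₊`, `K = ⌊ηM/7⌋₊` satisfy the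
eleven inequalities consumed by the composition `PolyDepthTwinsAbove_of` (witnesses
`k = ⌈8/θ⌉₊ + 1`, `θ' = 1/(2(k+1))`). -/
theorem stub_parameters {θ η g LB : ℝ} (hθ : 0 < θ) (hθ8 : θ < 1 / 8) (hη : 0 < η) (hg : 0 < g)
    (hLB : 0 < LB) (Lρ : ℝ) {d : ℕ} (hd : 3 ≤ d) (D N₀ : ℕ) :
    ∃ θ' : ℝ, 0 < θ' ∧ ∃ k : ℕ, ∀ n₀ : ℕ, ∃ m₁ : ℕ, ∀ m₀ : ℕ, m₁ ≤ m₀ →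
      ∀ M n κ₁ κ₂ K : ℕ, M = m₀ * 2 * (D + 1) → n = M ^ k → κ₁ = slyK θ n →
        κ₂ = ⌊(n : ℝ) ^ (θ / 4)⌋₊ → K = ⌊η * M / 7⌋₊ →
          N₀ ≤ n ∧
          Fintype.card (Fin κ₁ ⊕ (Fin 2 × Fin κ₂)) ≤ slyM d θ n ∧
          (6 * M : ℝ) ≤ (n : ℝ) ^ (θ / 4) ∧
          (κ₂ : ℝ) * (M * Lρ + g) ≤ κ₁ * LB ∧
          6 * (n : ℝ) ^ (6 * M) ≤ Real.exp (κ₂ * g) ∧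
          (2 * 3 * K : ℝ) < η * M ∧
          2 ≤ M ∧ 1 ≤ K ∧ 1 ≤ κ₂ ∧ n₀ ≤ M ∧
          ∀ v : ℕ, (v : ℝ) ≤ 3 * n → (((6 * M * v + 10 * M * κ₂ : ℕ) : ℝ)) ^ θ' ≤ K := by
  -- the exponent `k = ⌈8/θ⌉₊ + 1`: `k θ ≥ 8`, `k ≥ 1`
  obtain ⟨k, hk⟩ : ∃ k : ℕ, k = ⌈8 / θ⌉₊ + 1 := ⟨_, rfl⟩
  have hkge : 8 / θ ≤ (k : ℝ) := by
    rw [hk]; push_cast; linarith [Nat.le_ceil (8 / θ)]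
  have hk8 : 8 ≤ (k : ℝ) * θ := (div_le_iff₀ hθ).1 hkge
  have hk0 : k ≠ 0 := by omega
  have hkpos : (0 : ℝ) < k := Nat.cast_pos.2 (Nat.pos_of_ne_zero hk0)
  refine ⟨1 / (2 * ((k : ℝ) + 1)), by positivity, k, fun n₀ => ?_⟩
  -- the finitely many thresholds on `M`
  have hε : 0 < g / (12 * k) := by positivity
  obtain ⟨M₁, hM₁⟩ := Filter.eventually_atTop.1 ((Filter.eventually_ge_atTop (max 6 (3 * d))).and
    ((eventually_le_const_mul_natCast hLB (|Lρ| + g + LB)).and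
    ((eventually_log_le_mul_natCast hε).and
    ((eventually_le_const_mul_natCast hg (2 * (Real.log 6 + g))).and
    ((eventually_le_const_mul_natCast hη 14).and
    (eventually_le_const_mul_natCast (pow_pos hη 2) 5488))))))
  refine ⟨max M₁ (max n₀ N₀), fun m₀ hm₀ M n κ₁ κ₂ K hM hn hκ₁ hκ₂ hK => ?_⟩
  -- `M ≥ m₀` lies beyond every threshold
  have hMm : m₀ ≤ M := by
    rw [hM]
    calc m₀ = m₀ * 1 * 1 := by ring
      _ ≤ m₀ * 2 * (D + 1) := by gcongr <;> omega
  have hM₁M : M₁ ≤ M := ((le_max_left _ _).trans hm₀).trans hMm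
  have hn₀M : n₀ ≤ M := (((le_max_left _ _).trans (le_max_right _ _)).trans hm₀).trans hMm
  have hN₀M : N₀ ≤ M := (((le_max_right _ _).trans (le_max_right _ _)).trans hm₀).trans hMm
  obtain ⟨hT1, hT2, hT3, hT4, hT5, hT6⟩ := hM₁ M hM₁M
  have hM6 : 6 ≤ M := (le_max_left _ _).trans hT1
  have hM3d : 3 * d ≤ M := (le_max_right _ _).trans hT1
  have hM1 : 1 ≤ M := by omega
  have hMr0 : (0 : ℝ) ≤ M := Nat.cast_nonneg M
  have hMr1 : (1 : ℝ) ≤ M := by exact_mod_cast hM1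
  have hMr6 : (6 : ℝ) ≤ M := by exact_mod_cast hM6
  have hMr3d : (3 : ℝ) * d ≤ M := by exact_mod_cast hM3d
  have hMM2 : (M : ℝ) ≤ (M : ℝ) ^ 2 := by linarith [mul_le_mul_of_nonneg_left hMr1 hMr0]
  -- `n = M^k ≥ 1`
  have hnr : (n : ℝ) = (M : ℝ) ^ k := by rw [hn, Nat.cast_pow]
  have hn1 : 1 ≤ n := by rw [hn]; exact Nat.one_le_pow _ _ (by omega)
  have hnr1 : (1 : ℝ) ≤ n := by exact_mod_cast hn1
  have hnpos : (0 : ℝ) < n := by linarith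
  -- `n^{θ/4} = M^{kθ/4} ≥ M²`, `n^{3θ/4} = (n^{θ/4})³`, `n^{θ/4} ≤ n`
  have hM2b : (M : ℝ) ^ 2 ≤ (n : ℝ) ^ (θ / 4) := by
    rw [hnr, ← Real.rpow_natCast (M : ℝ) k, ← Real.rpow_mul hMr0, ← Real.rpow_two]
    exact Real.rpow_le_rpow_of_exponent_le hMr1 (by linarith)
  have hMb : (M : ℝ) ≤ (n : ℝ) ^ (θ / 4) := hMM2.trans hM2b
  have hb1 : (1 : ℝ) ≤ (n : ℝ) ^ (θ / 4) := hMr1.trans hMb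
  have hb0 : (0 : ℝ) ≤ (n : ℝ) ^ (θ / 4) := zero_le_one.trans hb1
  have h3b : (n : ℝ) ^ (3 * θ / 4) = ((n : ℝ) ^ (θ / 4)) ^ 3 := by
    rw [← Real.rpow_natCast _ 3, ← Real.rpow_mul hnpos.le]; congr 1; push_cast; ring
  have hbn : (n : ℝ) ^ (θ / 4) ≤ n :=
    calc (n : ℝ) ^ (θ / 4) ≤ (n : ℝ) ^ (1 : ℝ) :=
        Real.rpow_le_rpow_of_exponent_le hnr1 (by linarith)
      _ = n := Real.rpow_one _
  -- `κ₂`, `κ₁`, `K` against their real counterparts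
  have hκ₂b : (κ₂ : ℝ) ≤ (n : ℝ) ^ (θ / 4) := by rw [hκ₂]; exact Nat.floor_le hb0
  have hκ₂gt : (n : ℝ) ^ (θ / 4) - 1 < κ₂ := by
    rw [hκ₂]; linarith [Nat.lt_floor_add_one ((n : ℝ) ^ (θ / 4))]
  have hκ₁gt : ((n : ℝ) ^ (θ / 4)) ^ 3 - 1 < κ₁ := by
    rw [hκ₁]; unfold slyK; rw [h3b]
    linarith [Nat.lt_floor_add_one (((n : ℝ) ^ (θ / 4)) ^ 3)]
  have hK0 : (0 : ℝ) ≤ η * M / 7 := by positivity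
  have hKle : (K : ℝ) ≤ η * M / 7 := by rw [hK]; exact Nat.floor_le hK0
  have hKgt : η * M / 7 - 1 < K := by rw [hK]; linarith [Nat.lt_floor_add_one (η * M / 7)]
  -- (1) `N₀ ≤ M ≤ n`
  have hC1 : N₀ ≤ n := by rw [hn]; exact hN₀M.trans (Nat.le_self_pow hk0 M)
  -- (2) the slots fit: `κ₁ + 2κ₂ ≤ 3κ₁ ≤ slyM d θ n` (`3 (d - 1) ≤ M ≤ n^{θ/4}`)
  have hC2 : Fintype.card (Fin κ₁ ⊕ (Fin 2 × Fin κ₂)) ≤ slyM d θ n := by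
    have hcard : Fintype.card (Fin κ₁ ⊕ (Fin 2 × Fin κ₂)) = κ₁ + 2 * κ₂ := by
      simp only [Fintype.card_sum, Fintype.card_prod, Fintype.card_fin]
    have hκ₂₁ : κ₂ ≤ κ₁ := by
      rw [hκ₂, hκ₁]; unfold slyK
      exact Nat.floor_mono (Real.rpow_le_rpow_of_exponent_le hnr1 (by linarith))
    have hd3 : (3 : ℝ) ≤ d := by exact_mod_cast hd
    have h3 : ((3 : ℕ) : ℝ) ≤ (n : ℝ) ^ (θ / 4) / ((d : ℝ) - 1) := by
      rw [le_div_iff₀ (show (0 : ℝ) < (d : ℝ) - 1 by linarith)]; push_cast; linarith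
    have h3κ := mul_slyK_le_slyM hd hθ n 3 h3
    rw [← hκ₁] at h3κ
    omega
  -- (3) `6M ≤ M² ≤ n^{θ/4}`
  have hC3 : (6 * M : ℝ) ≤ (n : ℝ) ^ (θ / 4) := by
    linarith [mul_le_mul_of_nonneg_left hMr6 hMr0]
  -- (4) `κ₂ (M Lρ + g) ≤ n^{θ/4} (M |Lρ| + g) ≤ (n^{3θ/4} - 1) LB ≤ κ₁ LB`
  have hC4 : (κ₂ : ℝ) * (M * Lρ + g) ≤ κ₁ * LB := by
    have h1 : (M : ℝ) * Lρ + g ≤ M * |Lρ| + g := by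
      linarith [mul_le_mul_of_nonneg_left (le_abs_self Lρ) hMr0]
    have h2 : (0 : ℝ) ≤ M * |Lρ| + g := by positivity
    have hA : (κ₂ : ℝ) * (M * Lρ + g) ≤ (n : ℝ) ^ (θ / 4) * (M * |Lρ| + g) :=
      (mul_le_mul_of_nonneg_left h1 (Nat.cast_nonneg _)).trans
        (mul_le_mul_of_nonneg_right hκ₂b h2)
    have hbM1 : (1 : ℝ) ≤ (n : ℝ) ^ (θ / 4) * M := by
      linarith [mul_le_mul hb1 hMr1 zero_le_one hb0]
    have hB : (n : ℝ) ^ (θ / 4) * (M * |Lρ| + g) + LB ≤ ((n : ℝ) ^ (θ / 4)) ^ 3 * LB :=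
      calc (n : ℝ) ^ (θ / 4) * (M * |Lρ| + g) + LB
          ≤ (n : ℝ) ^ (θ / 4) * M * (|Lρ| + g + LB) := by
            linarith [mul_nonneg (mul_nonneg hb0 hg.le) (sub_nonneg.2 hMr1),
              mul_nonneg hLB.le (sub_nonneg.2 hbM1)]
        _ ≤ (n : ℝ) ^ (θ / 4) * M * (LB * M) := mul_le_mul_of_nonneg_left hT2 (by positivity)
        _ = LB * (n : ℝ) ^ (θ / 4) * (M : ℝ) ^ 2 := by ring
        _ ≤ LB * (n : ℝ) ^ (θ / 4) * (n : ℝ) ^ (θ / 4) :=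
            mul_le_mul_of_nonneg_left hM2b (by positivity)
        _ ≤ ((n : ℝ) ^ (θ / 4)) ^ 3 * LB := by
            linarith [mul_nonneg (mul_nonneg hLB.le (sq_nonneg ((n : ℝ) ^ (θ / 4))))
              (sub_nonneg.2 hb1)]
    have hC : (((n : ℝ) ^ (θ / 4)) ^ 3 - 1) * LB ≤ κ₁ * LB :=
      mul_le_mul_of_nonneg_right hκ₁gt.le hLB.le
    linarith
  -- (5) `6 n^{6M} ≤ exp(κ₂ g)`: `log 6 + 6 k M log M ≤ g (M² - 1) ≤ g κ₂`
  have hC5 : 6 * (n : ℝ) ^ (6 * M) ≤ Real.exp (κ₂ * g) := by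
    have h5a : 6 * (M : ℝ) * Real.log n ≤ g * (M : ℝ) ^ 2 / 2 := by
      rw [hnr, Real.log_pow]
      calc 6 * (M : ℝ) * (k * Real.log M) ≤ 6 * M * (k * (g / (12 * k) * M)) := by gcongr
        _ = g * (M : ℝ) ^ 2 / 2 := by field_simp; ring
    have h5b : Real.log 6 + g ≤ g * (M : ℝ) ^ 2 / 2 := by
      linarith [mul_le_mul_of_nonneg_left hMM2 hg.le]
    have h5c : Real.log 6 + 6 * M * Real.log n ≤ κ₂ * g := by
      linarith [mul_le_mul_of_nonneg_left hM2b hg.le, mul_le_mul_of_nonneg_left hκ₂gt.le hg.le]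
    have hpow : (n : ℝ) ^ (6 * M) = Real.exp (6 * M * Real.log n) := by
      rw [← Real.exp_log (pow_pos hnpos (6 * M)), Real.log_pow, Nat.cast_mul, Nat.cast_ofNat]
    have hlhs : (6 : ℝ) * (n : ℝ) ^ (6 * M) = Real.exp (Real.log 6 + 6 * M * Real.log n) := by
      rw [Real.exp_add, Real.exp_log (by norm_num : (0 : ℝ) < 6), hpow]
    rw [hlhs, Real.exp_le_exp]
    exact h5c
  -- (6) `6K ≤ 6ηM/7 < ηM`
  have hC6 : (2 * 3 * K : ℝ) < η * M := by linarith
  -- (7)–(9)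
  have hC7 : 2 ≤ M := by omega
  have hC8 : 1 ≤ K := by rw [hK]; exact Nat.le_floor (by push_cast; linarith)
  have hC9 : 1 ≤ κ₂ := by rw [hκ₂]; exact Nat.le_floor (by exact_mod_cast hb1)
  -- (11) `(6Mv + 10Mκ₂)^{θ'} ≤ ((K²)^{k+1})^{θ'} = K`
  have hC11 : ∀ v : ℕ, (v : ℝ) ≤ 3 * n →
      (((6 * M * v + 10 * M * κ₂ : ℕ) : ℝ)) ^ (1 / (2 * ((k : ℝ) + 1))) ≤ K := by
    intro v hv
    have hK14 : η * M / 14 ≤ K := by linarith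
    have hK2 : 28 * (M : ℝ) ≤ (K : ℝ) ^ 2 := by
      have h1 : (η * M / 14) ^ 2 ≤ (K : ℝ) ^ 2 := pow_le_pow_left₀ (by positivity) hK14 2
      linarith [mul_nonneg hMr0 (sub_nonneg.2 hT6)]
    have hκ₂n : (κ₂ : ℝ) ≤ n := hκ₂b.trans hbn
    have hN : ((6 * M * v + 10 * M * κ₂ : ℕ) : ℝ) ≤ (K : ℝ) ^ (2 * (k + 1)) := by
      push_cast
      calc (6 * M * v + 10 * M * κ₂ : ℝ) ≤ 6 * M * (3 * n) + 10 * M * n := by gcongr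
        _ = 28 * M * (M : ℝ) ^ k := by rw [hnr]; ring
        _ ≤ 28 * M * (28 * (M : ℝ)) ^ k := by gcongr; linarith
        _ = (28 * (M : ℝ)) ^ (k + 1) := by ring
        _ ≤ ((K : ℝ) ^ 2) ^ (k + 1) := by gcongr
        _ = (K : ℝ) ^ (2 * (k + 1)) := by rw [← pow_mul]
    have h2k : ((2 * (k + 1) : ℕ) : ℝ) * (1 / (2 * ((k : ℝ) + 1))) = 1 := by
      push_cast; exact mul_one_div_cancel (by positivity)
    calc (((6 * M * v + 10 * M * κ₂ : ℕ) : ℝ)) ^ (1 / (2 * ((k : ℝ) + 1)))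
        ≤ ((K : ℝ) ^ (2 * (k + 1))) ^ (1 / (2 * ((k : ℝ) + 1))) :=
          Real.rpow_le_rpow (Nat.cast_nonneg _) hN (by positivity)
      _ = K := by
          rw [← Real.rpow_natCast, ← Real.rpow_mul (Nat.cast_nonneg K), h2k, Real.rpow_one]
  exact ⟨hC1, hC2, hC3, hC4, hC5, hC6, hC7, hC8, hC9, hn₀M, hC11⟩

end Summit.PneNP.PneNP.Cruxes.PolyDepthTwinsAbove.ParityWiredPorts
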